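import Summits.NavierStokesRegularity.NavierStokesRegularity.Theorems.TypeIIInviscidRelaxationAxisymSwirlRegularZhangBarrier
import Summits.NavierStokesRegularity.NavierStokesRegularity.Theorems.TypeIIInviscidRelaxationAxisymSwirlRegularSplitTightness
import HarnessLib

/-!
# Crux `AxisymSwirlRegular` ⟺ an a-priori one-sided PARTIAL TYPE I bound on the radial velocity near the axis

Helper toward the crux `AxisymSwirlRegular` (stmt-NavierStokesRegularity-1964, route TypeIIInviscidRelaxation),
registered line `radial_inflow_split` (theorems only, no new definitions).

With Zhang's partial Type I criterion now a tree theorem at every viscosity on the unit tube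
(`hasSmoothExtensionPast_of_sqrtEnvelope`, from the explicit barrier of `…ZhangBarrier` and the comparison
engine of `…HalfLineBarrierCriterion(Visc)`), the crux acquires a second one-estimate currency next to
`axisymSwirlRegular_iff_aprioriRadialInflowBound_one` (`r u_r ≥ −ν` on an axis tube):

* `axisymSwirlRegular_iff_aprioriPartialTypeI` — `AxisymSwirlRegular` holds iff every solution of the standing
  axisymmetric class on `[0,T)` (classical on `[0,T)`, Leray–Hopf on `[0,T]` from a rapidly decaying datum,
  bounded on closed sub-slabs, axisymmetric slices) admits SOME constant `M` with
  `u_r ≥ −M √ν / √(T−t)` on the unit tube `0 < r ≤ 1` for all `t ∈ [0,T)`.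
  `←`: `hasSmoothExtensionPast_of_sqrtEnvelope` (any `M`; enlarge to `M > 0`) and `axisymSwirlRegular_of_noBlowup`;
  `→`: boundedness up to `T` (`hasSmoothExtensionPast_and_bounded_of_axisymSwirlRegular`) and `v_r ≥ −|v|`.
* `axisymSwirlRegular_iff_aprioriPartialTypeI_nearBlowup` — the same with the bound required only on
  `[T', T) × {0 < r ≤ 1}` for some `T' < T` (the closed slab `[0,T']` is bounded by hypothesis).

Reading (Zhang 2026, abstract: "potential blow ups for ASNS are caused by super-critical inward radial
velocity"), in kernel and by name of the crux: the open content of ⟨1964⟩ is EXACTLY an a-priori exclusion of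
supercritical INWARD radial velocity `u_r √(T−t) → −∞` along `t ↑ T` inside the unit tube; the constant is free
(contrast: the `r u_r ≥ −Cν` currency of ⟨19059⟩/⟨19060⟩ is tied to `C < 2`).

References: Qi S. Zhang, arXiv:2604.07785 (2026), Thm 1.1 and Abstract [Zhang2026PartialTypeI].
-/

noncomputable section

open Set Filter Topology
open Literature.Analysis.FluidPDE

namespace Summit.NavierStokesRegularity.NavierStokesRegularity.Theorems

set_option linter.dupNamespace false

open Summit.NavierStokesRegularity.NavierStokesRegularity.Theses.TypeIIInviscidRelaxation (AxisymSwirlRegular)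

/-- Under a uniform bound `‖u‖ ≤ B` on `[0,T) × ℝ³`, the partial Type I gate holds with
`M = max B 0 · √T / √ν`: `−(M√ν/√(T−t)) ≤ −B ≤ v_r`. [cite: Zhang2026PartialTypeI, Abstract and Thm. 1.1 (c)] -/
theorem partialTypeI_gate_of_bound {ν T B : ℝ} (hν : 0 < ν)
    {u : ℝ → EuclideanSpace ℝ (Fin 3) → EuclideanSpace ℝ (Fin 3)}
    (hB : ∀ t ∈ Ico 0 T, ∀ x, ‖u t x‖ ≤ B) :
    ∃ M : ℝ, ∀ t ∈ Ico 0 T, ∀ x : EuclideanSpace ℝ (Fin 3), 0 < cylRadius x → cylRadius x ≤ 1 →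
      -(M * √ν / √(T - t)) ≤ radialVelocity (u t) x := by
  refine ⟨max B 0 * √T / √ν, fun t ht x _ _ => ?_⟩
  have hs : 0 < T - t := by linarith [ht.2]
  have hsT : √(T - t) ≤ √T := Real.sqrt_le_sqrt (by linarith [ht.1])
  have hsq : 0 < √(T - t) := Real.sqrt_pos.2 hs
  have hν' : 0 < √ν := Real.sqrt_pos.2 hν
  have h1 : -‖u t x‖ ≤ radialVelocity (u t) x := neg_norm_le_radialVelocity (u t) x
  have h2 : ‖u t x‖ ≤ max B 0 := (hB t ht x).trans (le_max_left _ _)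
  have h3 : max B 0 ≤ max B 0 * √T / √ν * √ν / √(T - t) := by
    rw [div_mul_cancel₀ _ hν'.ne', le_div_iff₀ hsq]
    exact mul_le_mul_of_nonneg_left hsT (le_max_right _ _)
  linarith

/-- **The crux ⟺ an a-priori partial Type I bound on `u_r` in the unit tube.** `AxisymSwirlRegular` holds iff
every solution of the standing axisymmetric class on `[0,T)` at viscosity `ν` has, for SOME constant `M`,
`u_r ≥ −M√ν/√(T−t)` on `{0 < r ≤ 1} × [0,T)`.  `←`: the explicit-barrier form of Zhang's criterion
(`hasSmoothExtensionPast_of_sqrtEnvelope`, any `M > 0`) continues every such solution, and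
`axisymSwirlRegular_of_noBlowup` concludes; `→`: under the crux the solution is bounded up to `T`
(`hasSmoothExtensionPast_and_bounded_of_axisymSwirlRegular`) and `partialTypeI_gate_of_bound`.
[cite: Zhang2026PartialTypeI, Thm. 1.1 (arXiv:2604.07785)] -/
theorem axisymSwirlRegular_iff_aprioriPartialTypeI :
    AxisymSwirlRegular ↔
      ∀ (ν T : ℝ), 0 < ν → 0 < T →
        ∀ (u : ℝ → EuclideanSpace ℝ (Fin 3) → EuclideanSpace ℝ (Fin 3))
          (p : ℝ → EuclideanSpace ℝ (Fin 3) → ℝ),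
          IsClassicalNSSolutionOn (Ico 0 T) ν 0 u p → IsLerayHopfOn T ν 0 (u 0) u →
          (∀ T' < T, ∃ M : ℝ, ∀ t ∈ Icc 0 T', ∀ x, ‖u t x‖ ≤ M) →
          (∀ t ∈ Ico 0 T, IsAxisymmetric (u t)) → HasRapidSpatialDecay (u 0) →
          ∃ M : ℝ, ∀ t ∈ Ico 0 T, ∀ x : EuclideanSpace ℝ (Fin 3), 0 < cylRadius x → cylRadius x ≤ 1 →
            -(M * √ν / √(T - t)) ≤ radialVelocity (u t) x := by
  constructor
  · intro hAX ν T hν hT u p hcl hLH _hbd hax hdec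
    obtain ⟨-, B, hB⟩ := hasSmoothExtensionPast_and_bounded_of_axisymSwirlRegular hAX hν hT hcl hLH
      (hax 0 (left_mem_Ico.2 hT)) hdec
    exact partialTypeI_gate_of_bound hν hB
  · intro hPT
    refine axisymSwirlRegular_of_noBlowup fun ν T hν hT u p hcl hLH hbd hax hdec => ?_
    obtain ⟨M, hM⟩ := hPT ν T hν hT u p hcl hLH hbd hax hdec
    -- enlarge the constant to a positive one
    have hM' : ∀ t ∈ Ico 0 T, ∀ x : EuclideanSpace ℝ (Fin 3), 0 < cylRadius x → cylRadius x ≤ 1 →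
        -((max M 1) * √ν / √(T - t)) ≤ radialVelocity (u t) x := by
      intro t ht x hx hx1
      have hs : 0 < √(T - t) := Real.sqrt_pos.2 (by linarith [ht.2])
      have h1 := hM t ht x hx hx1
      have h2 : M * √ν / √(T - t) ≤ max M 1 * √ν / √(T - t) := by
        apply div_le_div_of_nonneg_right _ hs.le
        exact mul_le_mul_of_nonneg_right (le_max_left _ _) (Real.sqrt_nonneg _)
      linarith
    exact hasSmoothExtensionPast_of_sqrtEnvelope hν (lt_of_lt_of_le one_pos (le_max_right M 1)) hT hcl hLH
      hdec hax hM'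

/-- **Only the approach to the blow-up time matters:** `AxisymSwirlRegular` holds iff for every solution of the
standing axisymmetric class there are `T' < T` and `M` with `u_r ≥ −M√ν/√(T−t)` on `{0 < r ≤ 1} × [T',T)`:
on the closed slab `[0,T']` the solution is bounded by hypothesis, and there `−‖u‖ ≥ −B ≥ −B√T/√(T−t)`.
So the open content of the crux is the exclusion of `√(T−t) · inf_{0<r≤1} u_r → −∞` along `t ↑ T`.
[cite: Zhang2026PartialTypeI, Thm. 1.1 and Abstract] -/
theorem axisymSwirlRegular_iff_aprioriPartialTypeI_nearBlowup :
    AxisymSwirlRegular ↔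
      ∀ (ν T : ℝ), 0 < ν → 0 < T →
        ∀ (u : ℝ → EuclideanSpace ℝ (Fin 3) → EuclideanSpace ℝ (Fin 3))
          (p : ℝ → EuclideanSpace ℝ (Fin 3) → ℝ),
          IsClassicalNSSolutionOn (Ico 0 T) ν 0 u p → IsLerayHopfOn T ν 0 (u 0) u →
          (∀ T' < T, ∃ M : ℝ, ∀ t ∈ Icc 0 T', ∀ x, ‖u t x‖ ≤ M) →
          (∀ t ∈ Ico 0 T, IsAxisymmetric (u t)) → HasRapidSpatialDecay (u 0) →
          ∃ T' M : ℝ, T' < T ∧ ∀ t ∈ Ico T' T, ∀ x : EuclideanSpace ℝ (Fin 3),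
            0 < cylRadius x → cylRadius x ≤ 1 → -(M * √ν / √(T - t)) ≤ radialVelocity (u t) x := by
  rw [axisymSwirlRegular_iff_aprioriPartialTypeI]
  constructor
  · intro h ν T hν hT u p hcl hLH hbd hax hdec
    obtain ⟨M, hM⟩ := h ν T hν hT u p hcl hLH hbd hax hdec
    exact ⟨0, M, hT, fun t ht x hx hx1 => hM t ht x hx hx1⟩
  · intro h ν T hν hT u p hcl hLH hbd hax hdec
    obtain ⟨T', M, hT'T, hM⟩ := h ν T hν hT u p hcl hLH hbd hax hdec
    -- on `[0, T']` (if nonempty) the solution is bounded: combine the two constants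
    rcases lt_or_ge T' 0 with hT'0 | hT'0
    · exact ⟨M, fun t ht x hx hx1 => hM t ⟨(lt_of_lt_of_le hT'0 ht.1).le, ht.2⟩ x hx hx1⟩
    obtain ⟨B, hB⟩ := hbd T' hT'T
    -- gate constant from the slab bound, valid on `[0,T']`
    have hν' : 0 < √ν := Real.sqrt_pos.2 hν
    refine ⟨max M (max B 0 * √T / √ν), fun t ht x hx hx1 => ?_⟩
    have hs : 0 < T - t := by linarith [ht.2]
    have hsq : 0 < √(T - t) := Real.sqrt_pos.2 hs
    have hmono : ∀ K K' : ℝ, K ≤ K' → -(K' * √ν / √(T - t)) ≤ -(K * √ν / √(T - t)) := by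
      intro K K' hKK'
      have : K * √ν / √(T - t) ≤ K' * √ν / √(T - t) := by
        apply div_le_div_of_nonneg_right _ hsq.le
        exact mul_le_mul_of_nonneg_right hKK' (Real.sqrt_nonneg _)
      linarith
    rcases lt_or_ge t T' with htT' | htT'
    · -- `t ∈ [0, T')`: use the slab bound
      have h1 : -‖u t x‖ ≤ radialVelocity (u t) x := neg_norm_le_radialVelocity (u t) x
      have h2 : ‖u t x‖ ≤ max B 0 := (hB t ⟨ht.1, htT'.le⟩ x).trans (le_max_left _ _)
      have hsT : √(T - t) ≤ √T := Real.sqrt_le_sqrt (by linarith [ht.1])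
      have h3 : max B 0 ≤ max B 0 * √T / √ν * √ν / √(T - t) := by
        rw [div_mul_cancel₀ _ hν'.ne', le_div_iff₀ hsq]
        exact mul_le_mul_of_nonneg_left hsT (le_max_right _ _)
      have h4 := hmono _ _ (le_max_right M (max B 0 * √T / √ν))
      linarith
    · have h1 := hM t ⟨htT', ht.2⟩ x hx hx1
      have h4 := hmono _ _ (le_max_left M (max B 0 * √T / √ν))
      linarith

end Summit.NavierStokesRegularity.NavierStokesRegularity.Theorems

end
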